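import Summits.ResolutionOfSingularities.ResolutionOfSingularities.Theorems.WeightedInvariantIota3RowBBalanceTools

/-!
# (F-3h) Row B, the BALANCE case — the frame-free core  [OURS · L1 W4.3]

Kernel infrastructure for RE-ENTRY OBJECT #1 of chain w43 (door crux `stmt-ResolutionOfSingularities-19897`),
rung (F-3h): `rowB_core_anyFrame_balance` — the frame-free core for `f = y^p + Λ v^d + g + x^M` where, in case (β),
the engine only yields `W(v − v_0) ≥ r₂` and the equality case is settled by the balance coefficient
(`RowA.coeff_rest_balance`): `Λ·d·coeff_{X₁}R·ν + coeff_E(g − g_0) = 0` at `E = X₁X₀^{(d−1)m₀}`, `|E| < N`.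
The tails and the final theorem are in `…Iota3RowBBalance`.

[OURS · L1 W4.3] NOT a statement of the manuscript; AI-produced, gate-checked, weaker than expert review.
-/

set_option linter.dupNamespace false

namespace Summit.ResolutionOfSingularities.ResolutionOfSingularities.Theorems.LocalEngine.Iota3.RowA

open MvPowerSeries IsLocalRing
open Summit.ResolutionOfSingularities.ResolutionOfSingularities.Theorems.LocalEngine.Iota3.PClass
open Summit.ResolutionOfSingularities.ResolutionOfSingularities.Cruxes.HypersurfaceCentreConstruction.LocalEngine.Iota3

variable {K : Type*} [Field K]

/-! ## The core with the balance -/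

/-- **ROW B, CORE FORM, ARBITRARY FRAME, WITH THE BALANCE**: as `rowB_core_anyFrame'`, the hypothesis on
`W(g − g_0)` only for `a < ρ < r₂`, plus the vanishing of the `X₁X₀^{(d−1)m₀}`-coefficient of `g − g_0` at the
balance `W(v − v_0) = r₂` (given the initial-monomial data of `v`). -/
theorem rowB_core_anyFrame_balance (p : ℕ) [Fact p.Prime] [CharP K p] {d M q r₁ r₂ N : ℕ} (hpd : ¬ p ∣ d) (hlt : p < d)
    (hN₁ : p * r₁ = N) (hN₂ : d * r₂ = N) (hN₃ : M * q = N) (hq : 0 < q) (hqr : q < r₂) {Λ : K} (hΛ : Λ ≠ 0)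
    {x y v g : MvPowerSeries (Fin 3) K} (hx0 : constantCoeff x = 0) (hv0 : constantCoeff v = 0)
    (hy0 : constantCoeff y = 0)
    (hX0 : (X 0 : MvPowerSeries (Fin 3) K) ∈ Ideal.span {x, v, y})
    (hX1 : (X 1 : MvPowerSeries (Fin 3) K) ∈ Ideal.span {x, v, y})
    (hgp : ∀ i : Fin 3, coeff (p • Finsupp.single i 1) g = 0)
    (hgα : ∀ a : ℕ, v.weightedOrder ![q, r₂, r₁] = (a : ℕ∞) → a < r₂ →
      (((d * a : ℕ)) : ℕ∞) < g.weightedOrder ![q, r₂, r₁])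
    (hgβ : ∀ a ρ : ℕ, (pClassComponent p 0 v).weightedOrder ![q, r₂, r₁] = (a : ℕ∞) →
      (v - pClassComponent p 0 v).weightedOrder ![q, r₂, r₁] = (ρ : ℕ∞) → a < r₂ → a < ρ → ρ < r₂ →
      ((((d - 1) * a + ρ : ℕ)) : ℕ∞) < (g - pClassComponent p 0 g).weightedOrder ![q, r₂, r₁])
    (hgE : ∀ m₀ : ℕ, coeff (Finsupp.single 0 m₀) v ≠ 0 →
      (∀ e, coeff e v ≠ 0 → e ≠ Finsupp.single 0 m₀ →
        Finsupp.weight ![q, r₂, r₁] (Finsupp.single 0 m₀) < Finsupp.weight ![q, r₂, r₁] e) →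
      q * m₀ < r₂ → p ∣ m₀ → (v - pClassComponent p 0 v).weightedOrder ![q, r₂, r₁] = (r₂ : ℕ∞) →
      coeff (Finsupp.single 1 1 + Finsupp.single 0 ((d - 1) * m₀)) (g - pClassComponent p 0 g) = 0)
    (hreach : (N : ℕ∞) ≤ (y ^ p + C Λ * v ^ d + g + x ^ M).weightedOrder ![q, r₂, r₁]) :
    (r₂ : ℕ∞) ≤ v.weightedOrder ![q, r₂, r₁] := by
  classical
  -- numerics
  have hp : p.Prime := Fact.out
  have hp2 : 2 ≤ p := hp.two_le
  have hd2 : 2 ≤ d := by omega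
  have hr₂ : 0 < r₂ := by omega
  have hr₂r₁ : r₂ < r₁ := by
    by_contra h
    push Not at h
    have h1 : p * r₁ ≤ p * r₂ := Nat.mul_le_mul_left _ h
    have h2 : p * r₂ < d * r₂ := Nat.mul_lt_mul_of_pos_right hlt hr₂
    omega
  have hpr₂N : p * r₂ < N := by
    have := Nat.mul_lt_mul_of_pos_left hr₂r₁ hp.pos
    omega
  have hpM : p < M := by
    by_contra h
    push Not at h
    have h1 : M * q ≤ p * q := Nat.mul_le_mul_right _ h
    have h2 : p * q < p * r₁ := Nat.mul_lt_mul_of_pos_left (hqr.trans hr₂r₁) hp.pos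
    omega
  have hpqN : p * q < N := by
    have := Nat.mul_lt_mul_of_pos_right hpM hq
    omega
  haveI : NeZero p := ⟨hp.ne_zero⟩
  haveI : Fact (1 < p) := ⟨hp.one_lt⟩
  -- `x^M` and `h = y^p + Λ v^d + g` weigh at least `N`
  have hWxM : (N : ℕ∞) ≤ (x ^ M).weightedOrder ![q, r₂, r₁] :=
    le_weightedOrder_pow_of_constantCoeff_eq_zero hqr.le hr₂r₁.le hN₃ hx0
  have hWh : (N : ℕ∞) ≤ (y ^ p + C Λ * v ^ d + g).weightedOrder ![q, r₂, r₁] := by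
    have hX : (N : ℕ∞) ≤ (-(x ^ M)).weightedOrder ![q, r₂, r₁] := by rwa [weightedOrder_neg]
    have h := min_weightedOrder_le_add (w := ![q, r₂, r₁]) (f := y ^ p + C Λ * v ^ d + g + x ^ M) (g := -(x ^ M))
    rw [add_neg_cancel_right] at h
    exact le_trans (le_min hreach hX) h
  by_contra hvlt
  push Not at hvlt
  -- the initial form of `v` is `μ X₀^{m₀}`, `q m₀ < r₂`
  obtain ⟨m₀, hcm, hWv, ham, hini⟩ := initialMonomial_of_weightedOrder_lt hq hr₂r₁.le hvlt
  have hm₀ : 0 < m₀ := by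
    by_contra h0
    have h0 : m₀ = 0 := by omega
    rw [h0, Finsupp.single_zero, coeff_zero_eq_constantCoeff_apply, hv0] at hcm
    exact hcm rfl
  -- `y` has neither `X₀`- nor `X₁`-term
  have hy₀ : coeff (Finsupp.single 0 1) y = 0 :=
    coeff_linear_eq_zero_of_reach_add p hlt hpM _ 0 (show p * q < N from hpqN) hv0 hx0 (hgp 0) hreach
  have hy₁ : coeff (Finsupp.single 1 1) y = 0 :=
    coeff_linear_eq_zero_of_reach_add p hlt hpM _ 1 (show p * r₂ < N from hpr₂N) hv0 hx0 (hgp 1) hreach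
  by_cases hpm : p ∣ m₀
  · /- CASE (β) -/
    have hclass : exponentClass p (Finsupp.single (0 : Fin 3) m₀) = 0 := by
      rw [exponentClass_eq_zero_iff]
      intro i
      rw [Finsupp.single_apply]
      split_ifs
      · exact hpm
      · exact dvd_zero p
    have hWG : (pClassComponent p 0 v).weightedOrder ![q, r₂, r₁] = ((q * m₀ : ℕ) : ℕ∞) := by
      have h := weightedOrder_pClassComponent_of_initialMonomial (![q, r₂, r₁]) p hcm hini
      rw [hclass, weight_single_zero] at h
      exact h
    have hR := r₂_le_weightedOrder_rest_add p hpd hd2 hN₂ hqr hΛ hcm hini ham hpm g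
      (fun ρ hρ hlt' hle => hgβ (q * m₀) ρ hWG hρ ham hlt' hle) hWh
    have hR₀ : coeff (Finsupp.single 0 1) (v - pClassComponent p 0 v) = 0 := by
      refine coeff_eq_zero_of_lt_weightedOrder (![q, r₂, r₁]) (lt_of_lt_of_le ?_ hR)
      rw [weight_single_zero, mul_one, Nat.cast_lt]
      exact hqr
    have hR₁ : coeff (Finsupp.single 1 1) (v - pClassComponent p 0 v) = 0 := by
      rcases hR.lt_or_eq with hlt' | heq
      · exact coeff_eq_zero_of_lt_weightedOrder (![q, r₂, r₁]) (by rwa [weight_single_one])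
      · /- THE BALANCE `W(v − v_0) = r₂`: read `coeff_{X₁} R` off the coefficient of `X₁ X₀^{(d−1)m₀}` in `h − h_0` -/
        have hWReq := heq.symm
        obtain ⟨hbal, hν⟩ := coeff_rest_balance p hd2 hcm hini ham hpm (r₁ := r₁) hWReq
        have hwE : Finsupp.weight ![q, r₂, r₁] (Finsupp.single 1 1 + Finsupp.single 0 ((d - 1) * m₀)) < N := by
          rw [weight_single_one_add, ← hN₂]
          have h1 : q * ((d - 1) * m₀) = (d - 1) * (q * m₀) := by ring
          rw [h1]
          have h2 : (d - 1) * (q * m₀) ≤ (d - 1) * (r₂ - 1) := Nat.mul_le_mul_left _ (by omega)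
          have h3 : r₂ + (d - 1) * (r₂ - 1) < d * r₂ := by
            obtain ⟨j, rfl⟩ := Nat.exists_eq_add_of_le hd2
            obtain ⟨i, rfl⟩ := Nat.exists_eq_add_of_le (Nat.one_le_of_lt hqr)
            rw [show 2 + j - 1 = j + 1 by omega, show 1 + i - 1 = i by omega]
            nlinarith
          omega
        have hhQ : y ^ p + C Λ * v ^ d + g - pClassComponent p 0 (y ^ p + C Λ * v ^ d + g) =
            C Λ * (v ^ d - pClassComponent p 0 (v ^ d)) + (g - pClassComponent p 0 g) := by
          rw [pClassComponent_add, pClassComponent_add, pClassComponent_zero_pow_expChar, pClassComponent_C_mul]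
          ring
        have hz : coeff (Finsupp.single 1 1 + Finsupp.single 0 ((d - 1) * m₀))
            (y ^ p + C Λ * v ^ d + g - pClassComponent p 0 (y ^ p + C Λ * v ^ d + g)) = 0 :=
          coeff_eq_zero_of_lt_weightedOrder _ (lt_of_lt_of_le (by exact_mod_cast hwE)
            (hWh.trans (le_weightedOrder_sub_pClassComponent _ p 0 _)))
        rw [hhQ, map_add, coeff_C_mul, hbal, hgE m₀ hcm hini ham hpm hWReq, add_zero] at hz
        have hdK : (d : K) ≠ 0 := (CharP.cast_eq_zero_iff K p d).not.mpr hpd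
        rcases mul_eq_zero.mp hz with h | h
        · exact absurd h hΛ
        rcases mul_eq_zero.mp h with h | h
        · exact absurd h hdK
        rcases mul_eq_zero.mp h with h | h
        · exact h
        · exact absurd h hν
    have hcl : ∀ i : Fin 3, exponentClass p (Finsupp.single i 1) ≠ 0 := fun i h => by
      have h1 := congr_fun h i
      rw [exponentClass_apply, Finsupp.single_eq_same, Nat.cast_one, Pi.zero_apply] at h1
      exact one_ne_zero h1
    have hG₀ : coeff (Finsupp.single 0 1) (pClassComponent p 0 v) = 0 := coeff_pClassComponent_of_ne (hcl 0) v
    have hG₁ : coeff (Finsupp.single 1 1) (pClassComponent p 0 v) = 0 := coeff_pClassComponent_of_ne (hcl 1) v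
    have hsplit : v = (v - pClassComponent p 0 v) + pClassComponent p 0 v := (sub_add_cancel v _).symm
    have hv₀ : coeff (Finsupp.single 0 1) v = 0 := by rw [hsplit, map_add, hR₀, hG₀, add_zero]
    have hv₁ : coeff (Finsupp.single 1 1) v = 0 := by rw [hsplit, map_add, hR₁, hG₁, add_zero]
    exact false_of_frame₂ hX0 hX1 hx0 hv0 hy0 hv₀ hv₁ hy₀ hy₁
  · /- CASE (α) -/
    have hdm : ¬ p ∣ d * m₀ := fun h => (hp.dvd_mul.mp h).elim hpd hpm
    have hwt : Finsupp.weight ![q, r₂, r₁] (Finsupp.single 0 (d * m₀)) < N := by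
      rw [weight_single_zero, ← hN₂]
      nlinarith
    have hwg : (Finsupp.weight ![q, r₂, r₁] (Finsupp.single 0 (d * m₀)) : ℕ∞) < g.weightedOrder ![q, r₂, r₁] := by
      rw [weight_single_zero, show q * (d * m₀) = d * (q * m₀) by ring]
      exact hgα (q * m₀) hWv ham
    have hz : coeff (Finsupp.single 0 (d * m₀)) (y ^ p + C Λ * v ^ d + g + x ^ M) = 0 :=
      coeff_eq_zero_of_lt_weightedOrder _ (lt_of_lt_of_le (by exact_mod_cast hwt) hreach)
    rw [map_add, map_add, map_add, coeff_pow_expChar_eq_zero p y (i := 0) (by rwa [Finsupp.single_eq_same]), zero_add,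
      coeff_C_mul, coeff_eq_zero_of_lt_weightedOrder _ hwg, add_zero,
      coeff_eq_zero_of_lt_weightedOrder _ (lt_of_lt_of_le (by exact_mod_cast hwt) hWxM), add_zero] at hz
    exact (mul_ne_zero hΛ (coeff_single_pow_ne_zero hcm hini (by omega))) hz

end Summit.ResolutionOfSingularities.ResolutionOfSingularities.Theorems.LocalEngine.Iota3.RowA
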